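import Summits.CriticalPhenomena.SAWScalingLimit.Theorems.SAWTotalPositivityBoundaryHarnackRealisation

/-!
# The corridor gadget for `BoundaryHarnack` (stmt-CriticalPhenomena-7120): definitions

Objects of the converse / hardness direction `BoundaryHarnack ⇒ uniform critical half-plane arch
bound` (route `SAWTotalPositivity`), kept in their own reviewed file; all lemmas about them are in the
proof files `…Gadget`, `…GadgetWeights`, `…Converse`. Sites in `ℤ²`, mesh `1`, parameters `N, M ≥ 2`:

* `halfBox N` — the **notched half-box** `Λ_N = ([-N, N] × [0, N]) \ {(0,1)}` with the marked
  boundary sites `b' = (-1,0)`, `b = (0,0)`, `c = (1,0)` (`deg_{Λ_N}(b) = 2`) and the gateway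
  `g_R = (-N, 0)`;
* `cor N M : ℕ → ℤ²` — the **corridor**: `cor 0 = t = (-1,-1)`, down the column `-1` to `(-1,-M)`,
  left along the row `-M` to `(-N-1,-M)`, up the column `-N-1` to `g_L = (-N-1,0) = cor (m-1)`, and
  `cor m = g_R`, `m = 2M + N` (constant afterwards); `corSet N M` — the corridor sites (indices `< m`);
* `gadget N M = halfBox N ∪ corSet N M` — the **gadget** `V`;
* `gadgetDomain N M`, `halfBoxDomain N` — the bounded star-convex planar domains realising `ℤ²[V]`
  and `ℤ²[Λ_N]` at mesh `1` (`Realisation.realise`).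
[folklore]
-/

noncomputable section

namespace Summit.CriticalPhenomena.SAWScalingLimit.Theorems.BoundaryHarnack.Negative

open Literature.Probability.LatticeModels Set
open Summit.CriticalPhenomena.SAWScalingLimit.Theorems.BoundaryHarnack.Realisation

/-- The notched half-box `Λ_N = ([-N, N] × [0, N]) \ {(0,1)}`. [folklore] -/
def halfBox (N : ℕ) : Set (Site 2) :=
  {x | -(N : ℤ) ≤ x 0 ∧ x 0 ≤ N ∧ 0 ≤ x 1 ∧ x 1 ≤ N ∧ ¬ (x 0 = 0 ∧ x 1 = 1)}

/-- Membership in the notched half-box, in coordinates. [folklore] -/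
theorem mem_halfBox_iff {N : ℕ} {x : Site 2} : x ∈ halfBox N ↔
    -(N : ℤ) ≤ x 0 ∧ x 0 ≤ N ∧ 0 ≤ x 1 ∧ x 1 ≤ N ∧ ¬ (x 0 = 0 ∧ x 1 = 1) := Iff.rfl

/-- The corridor parametrisation `cor N M : ℕ → ℤ²` (constant `= g_R` from index `m = 2M+N` on).
[folklore] -/
def cor (N M : ℕ) (i : ℕ) : Site 2 :=
  if (i : ℤ) + 1 ≤ M then ![-1, -1 - (i : ℤ)]
  else if (i : ℤ) ≤ (M : ℤ) - 1 + N then ![(M : ℤ) - i - 2, -(M : ℤ)]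
  else if (i : ℤ) ≤ 2 * (M : ℤ) + N - 1 then ![-(N : ℤ) - 1, (i : ℤ) - 2 * M - N + 1]
  else ![-(N : ℤ), 0]

/-- The corridor sites: indices `< m = 2M + N` (this excludes the gateway `g_R = cor N M m`,
which belongs to the half-box). [folklore] -/
def corSet (N M : ℕ) : Set (Site 2) := {x | ∃ i : ℕ, i < 2 * M + N ∧ x = cor N M i}

/-- **The gadget** `V = Λ_N ∪ corridor`. [folklore] -/
def gadget (N M : ℕ) : Set (Site 2) := halfBox N ∪ corSet N M

/-- The gadget domain `Ω_V ⊆ ℂ` (bounded, star-convex; `(Ω_V)_1 = ℤ²[V]`, see `…GadgetWeights`).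
[folklore] -/
def gadgetDomain (N M : ℕ) : Set ℂ :=
  realise ![-(N : ℤ) - 1, -(M : ℤ)] ![(N : ℤ), N] (gadget N M)

/-- The notched half-box domain `Ω_Λ ⊆ ℂ` (`(Ω_Λ)_1 = ℤ²[Λ_N]`). [folklore] -/
def halfBoxDomain (N : ℕ) : Set ℂ :=
  realise ![-(N : ℤ), 0] ![(N : ℤ), N] (halfBox N)

end Summit.CriticalPhenomena.SAWScalingLimit.Theorems.BoundaryHarnack.Negative
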